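import Mathlib

/-!
# Frame-capacity toolkit B: Krylov image, rank–nullity, concavity of Krylov dimensions

Support file for crux item `stmt-MatrixMultiplication-10752`
(`Summit.MatrixMultiplication.MatrixMultiplication.Theses.HiddenToeplitzCorners.HiddenCornerLemmaR`),
line `frobenius-dual-short-syzygies` (engine of `stub_gconstDualLaw` / the strip theorem,
§1 (K1), (R1), (T1) of the lead's paper proof).  Pure linear algebra over `ℂ[X]`; no matrices.

Setting.  A frame `e : Fin r → ℂ[X]`, the down-shift `δ := Polynomial.divX`, and coefficient
polynomials `α` acting through `act α f := Σ_i (coeff α i) • δ^[i] f` (`Polynomial.lsum`).  The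
evaluation map of the frame is `Ev α := Σ_c act (α c) (e c)`, the degree-`< w` tuples form the
`Submodule.pi` of `Polynomial.degreeLT ℂ w`, the relations are `Rel_w := ker Ev ⊓ (degree < w)`
and the Krylov space is `K_w := span {δ^[i] (e c) : c, i < w}`.  The helper lemmas are stated for
an arbitrary family `K : ℕ → Submodule ℂ ℂ[X]` satisfying the defining equation `hK` of the Krylov
spaces and an arbitrary linear map `Ev` satisfying the defining equation `hEv` of the evaluation
map, so that neither a definition nor a notation is introduced; the five registered statements are
the closed, notation-free expansions.

Results (all folklore linear algebra):
* `hclR_EvL_map_degLT` : `Ev (degree < w) = K_w`;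
* `hclR_finrank_RelL_add_KryL` : rank–nullity `dim Rel_w + dim K_w = r w`;
* `hclR_KryL_succ` : `K_{w+1} = span e ⊔ span (δ '' K_w)`;
* `hclR_KryL_mono` : `K_w ≤ K_{w+1}`;
* `hclR_KryL_concave` : `κ_{w+2} + κ_w ≤ 2 κ_{w+1}` for `κ_j := dim K_j`, via the abstract step
  `hclR_finrank_concave_step`: if `K₀ ≤ K₁`, `D K₀ ≤ K₁` and `K₂ = K₁ ⊔ D K₁` then
  `dim K₂ + dim K₀ ≤ 2 dim K₁` (rank–nullity for `D` on `K₀`, `K₁` plus the modular law).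
`divX` is only bundled as an additive hom in Mathlib (`Polynomial.divX_hom`); here it is used as a
`ℂ`-linear map through the existence statement `hclR_exists_divX_linear` (no new definition).
-/

-- the problem namespace `…MatrixMultiplication.MatrixMultiplication…` repeats a component by design
set_option linter.dupNamespace false

namespace Summit.MatrixMultiplication.MatrixMultiplication.Theorems

open Polynomial

variable {r : ℕ} (e : Fin r → ℂ[X])

/-! ## `divX` is `ℂ`-linear -/

/-- `divX (a • p) = a • divX p`: the down-shift commutes with scalars. -/
theorem hclR_divX_smul (a : ℂ) (p : ℂ[X]) : Polynomial.divX (a • p) = a • Polynomial.divX p := by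
  simp only [smul_eq_C_mul]
  exact divX_C_mul

/-- There is a `ℂ`-linear endomorphism of `ℂ[X]` that is pointwise `Polynomial.divX`
(Mathlib bundles `divX` only as the additive hom `Polynomial.divX_hom`). -/
theorem hclR_exists_divX_linear : ∃ D : ℂ[X] →ₗ[ℂ] ℂ[X], ∀ p, D p = Polynomial.divX p :=
  ⟨⟨⟨Polynomial.divX, fun _ _ => divX_add⟩, hclR_divX_smul⟩, fun _ => rfl⟩

/-! ## Krylov spaces: generators, monotonicity, the successor formula

`K` is any family with `K w = span {divX^[i] (e c) : c, i < w}` (hypothesis `hK`). -/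

/-- The generator `divX^[i] (e c)` (`i < w`) lies in the Krylov space `K w`. -/
theorem hclR_iterate_divX_mem_K (K : ℕ → Submodule ℂ ℂ[X])
    (hK : ∀ w, K w = Submodule.span ℂ (Set.range (fun p : Fin r × Fin w =>
      Polynomial.divX^[(Prod.snd p).val] (e (Prod.fst p)))))
    (w : ℕ) (c : Fin r) (i : ℕ) (hi : i < w) : Polynomial.divX^[i] (e c) ∈ K w := by
  rw [hK]
  exact Submodule.subset_span ⟨(c, ⟨i, hi⟩), rfl⟩

/-- The Krylov spaces are finite-dimensional (spanned by `r w` vectors). -/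
theorem hclR_K_finiteDimensional (K : ℕ → Submodule ℂ ℂ[X])
    (hK : ∀ w, K w = Submodule.span ℂ (Set.range (fun p : Fin r × Fin w =>
      Polynomial.divX^[(Prod.snd p).val] (e (Prod.fst p)))))
    (w : ℕ) : FiniteDimensional ℂ ↥(K w) := by
  rw [hK]
  exact FiniteDimensional.span_of_finite ℂ (Set.finite_range _)

/-- Krylov spaces are monotone: `K w ≤ K (w + 1)`. -/
theorem hclR_K_mono (K : ℕ → Submodule ℂ ℂ[X])
    (hK : ∀ w, K w = Submodule.span ℂ (Set.range (fun p : Fin r × Fin w =>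
      Polynomial.divX^[(Prod.snd p).val] (e (Prod.fst p)))))
    (w : ℕ) : K w ≤ K (w + 1) := by
  rw [hK, hK]
  apply Submodule.span_mono
  rintro _ ⟨⟨c, i⟩, rfl⟩
  exact ⟨(c, Fin.castSucc i), rfl⟩

/-- `divX` maps `K w` into `K (w + 1)`. -/
theorem hclR_divX_mem_K_succ (K : ℕ → Submodule ℂ ℂ[X])
    (hK : ∀ w, K w = Submodule.span ℂ (Set.range (fun p : Fin r × Fin w =>
      Polynomial.divX^[(Prod.snd p).val] (e (Prod.fst p)))))
    (w : ℕ) (x : ℂ[X]) (hx : x ∈ K w) : Polynomial.divX x ∈ K (w + 1) := by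
  rw [hK] at hx
  induction hx using Submodule.span_induction with
  | mem y hy =>
    obtain ⟨⟨c, i⟩, rfl⟩ := hy
    have h : Polynomial.divX (Polynomial.divX^[i.val] (e c)) =
        Polynomial.divX^[i.val + 1] (e c) :=
      (Function.iterate_succ_apply' Polynomial.divX i.val (e c)).symm
    rw [h]
    exact hclR_iterate_divX_mem_K e K hK (w + 1) c (i.val + 1) (by omega)
  | zero => rw [divX_zero]; exact Submodule.zero_mem _
  | add y z _ _ hy hz => rw [divX_add]; exact Submodule.add_mem _ hy hz
  | smul a y _ hy => rw [hclR_divX_smul]; exact Submodule.smul_mem _ a hy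

/-- Successor formula `K (w + 1) = span e ⊔ span (divX '' K w)`: the generators of `K (w + 1)`
are the frame vectors (`i = 0`) and the shifts of the generators of `K w`. -/
theorem hclR_K_succ (K : ℕ → Submodule ℂ ℂ[X])
    (hK : ∀ w, K w = Submodule.span ℂ (Set.range (fun p : Fin r × Fin w =>
      Polynomial.divX^[(Prod.snd p).val] (e (Prod.fst p)))))
    (w : ℕ) : K (w + 1) = Submodule.span ℂ (Set.range e) ⊔
      Submodule.span ℂ (Polynomial.divX '' (K w : Set ℂ[X])) := by
  apply le_antisymm
  · rw [hK, Submodule.span_le]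
    rintro _ ⟨⟨c, i⟩, rfl⟩
    rcases i with ⟨_ | j, hj⟩
    · exact Submodule.mem_sup_left (Submodule.subset_span ⟨c, rfl⟩)
    · show Polynomial.divX^[j + 1] (e c) ∈ _
      rw [Function.iterate_succ_apply']
      exact Submodule.mem_sup_right
        (Submodule.subset_span ⟨_, hclR_iterate_divX_mem_K e K hK w c j (by omega), rfl⟩)
  · apply sup_le
    · rw [Submodule.span_le]
      rintro _ ⟨c, rfl⟩
      exact hclR_iterate_divX_mem_K e K hK (w + 1) c 0 (Nat.succ_pos w)
    · rw [Submodule.span_le]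
      rintro _ ⟨x, hx, rfl⟩
      exact hclR_divX_mem_K_succ e K hK w x hx

/-- Successor formula with a bundled shift: `K (w + 1) = span e ⊔ D (K w)` for any linear `D` that
is pointwise `divX`. -/
theorem hclR_K_succ_map (K : ℕ → Submodule ℂ ℂ[X])
    (hK : ∀ w, K w = Submodule.span ℂ (Set.range (fun p : Fin r × Fin w =>
      Polynomial.divX^[(Prod.snd p).val] (e (Prod.fst p)))))
    (D : ℂ[X] →ₗ[ℂ] ℂ[X]) (hD : ∀ p, D p = Polynomial.divX p) (w : ℕ) :
    K (w + 1) = Submodule.span ℂ (Set.range e) ⊔ Submodule.map D (K w) := by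
  have hcoe : (⇑D : ℂ[X] → ℂ[X]) = Polynomial.divX := funext hD
  have himg : Polynomial.divX '' (K w : Set ℂ[X]) = D '' (K w : Set ℂ[X]) := by rw [hcoe]
  rw [hclR_K_succ e K hK w, himg, Submodule.span_image, Submodule.span_eq]

/-- `D (K w) ≤ K (w + 1)` for any linear `D` that is pointwise `divX`. -/
theorem hclR_map_K_le_succ (K : ℕ → Submodule ℂ ℂ[X])
    (hK : ∀ w, K w = Submodule.span ℂ (Set.range (fun p : Fin r × Fin w =>
      Polynomial.divX^[(Prod.snd p).val] (e (Prod.fst p)))))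
    (D : ℂ[X] →ₗ[ℂ] ℂ[X]) (hD : ∀ p, D p = Polynomial.divX p) (w : ℕ) :
    Submodule.map D (K w) ≤ K (w + 1) := by
  rw [hclR_K_succ_map e K hK D hD w]
  exact le_sup_right

/-- `K (w + 2) = K (w + 1) ⊔ D (K (w + 1))` for any linear `D` that is pointwise `divX`. -/
theorem hclR_K_succ_succ (K : ℕ → Submodule ℂ ℂ[X])
    (hK : ∀ w, K w = Submodule.span ℂ (Set.range (fun p : Fin r × Fin w =>
      Polynomial.divX^[(Prod.snd p).val] (e (Prod.fst p)))))
    (D : ℂ[X] →ₗ[ℂ] ℂ[X]) (hD : ∀ p, D p = Polynomial.divX p) (w : ℕ) :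
    K (w + 2) = K (w + 1) ⊔ Submodule.map D (K (w + 1)) := by
  have h2 := hclR_K_succ_map e K hK D hD (w + 1)
  have hE : Submodule.span ℂ (Set.range e) ≤ K (w + 1) := by
    rw [hclR_K_succ_map e K hK D hD w]
    exact le_sup_left
  apply le_antisymm
  · rw [h2]
    exact sup_le (hE.trans le_sup_left) le_sup_right
  · exact sup_le (hclR_K_mono e K hK (w + 1)) (hclR_map_K_le_succ e K hK D hD (w + 1))

/-! ## The evaluation map and the Krylov image

`Ev` is any linear map with `Ev = Σ_c act(e c) ∘ proj c` (hypothesis `hEv`). -/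

/-- The action of the monomial `X ^ i` is the `i`-fold shift: `act (X ^ i) f = divX^[i] f`. -/
theorem hclR_act_X_pow (f : ℂ[X]) (i : ℕ) :
    Polynomial.lsum (fun (j : ℕ) => LinearMap.smulRight (LinearMap.id : ℂ →ₗ[ℂ] ℂ)
      (Polynomial.divX^[j] f)) (X ^ i) = Polynomial.divX^[i] f := by
  rw [Polynomial.lsum_apply, X_pow_eq_monomial, sum_monomial_index] <;> simp

/-- The evaluation map on a tuple: `Ev α = Σ_c Σ_i coeff (α c) i • divX^[i] (e c)`. -/
theorem hclR_Ev_apply (Ev : (Fin r → ℂ[X]) →ₗ[ℂ] ℂ[X])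
    (hEv : Ev = ∑ c : Fin r, LinearMap.comp
      (Polynomial.lsum (fun (i : ℕ) => LinearMap.smulRight (LinearMap.id : ℂ →ₗ[ℂ] ℂ)
        (Polynomial.divX^[i] (e c))) : ℂ[X] →ₗ[ℂ] ℂ[X])
      (LinearMap.proj c : (Fin r → ℂ[X]) →ₗ[ℂ] ℂ[X]))
    (α : Fin r → ℂ[X]) :
    Ev α = ∑ c : Fin r, (α c).sum (fun i a => a • Polynomial.divX^[i] (e c)) := by
  subst hEv
  simp [Polynomial.lsum_apply]

/-- The evaluation map on a tuple supported at one index and a monomial: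
`Ev (single c (X ^ i)) = divX^[i] (e c)`. -/
theorem hclR_Ev_single_X_pow (Ev : (Fin r → ℂ[X]) →ₗ[ℂ] ℂ[X])
    (hEv : Ev = ∑ c : Fin r, LinearMap.comp
      (Polynomial.lsum (fun (i : ℕ) => LinearMap.smulRight (LinearMap.id : ℂ →ₗ[ℂ] ℂ)
        (Polynomial.divX^[i] (e c))) : ℂ[X] →ₗ[ℂ] ℂ[X])
      (LinearMap.proj c : (Fin r → ℂ[X]) →ₗ[ℂ] ℂ[X]))
    (c : Fin r) (i : ℕ) : Ev (Pi.single c (X ^ i)) = Polynomial.divX^[i] (e c) := by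
  subst hEv
  rw [LinearMap.sum_apply, Finset.sum_eq_single c]
  · simpa using hclR_act_X_pow (e c) i
  · intro b _ hb
    simp [Pi.single_eq_of_ne hb]
  · intro h
    exact absurd (Finset.mem_univ c) h

/-- `Ev` maps degree-`< w` tuples into `K w`. -/
theorem hclR_Ev_mem_K (K : ℕ → Submodule ℂ ℂ[X])
    (hK : ∀ w, K w = Submodule.span ℂ (Set.range (fun p : Fin r × Fin w =>
      Polynomial.divX^[(Prod.snd p).val] (e (Prod.fst p)))))
    (Ev : (Fin r → ℂ[X]) →ₗ[ℂ] ℂ[X])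
    (hEv : Ev = ∑ c : Fin r, LinearMap.comp
      (Polynomial.lsum (fun (i : ℕ) => LinearMap.smulRight (LinearMap.id : ℂ →ₗ[ℂ] ℂ)
        (Polynomial.divX^[i] (e c))) : ℂ[X] →ₗ[ℂ] ℂ[X])
      (LinearMap.proj c : (Fin r → ℂ[X]) →ₗ[ℂ] ℂ[X]))
    (w : ℕ) (α : Fin r → ℂ[X])
    (hα : α ∈ Submodule.pi Set.univ (fun _ : Fin r => Polynomial.degreeLT ℂ w)) :
    Ev α ∈ K w := by
  rw [hclR_Ev_apply e Ev hEv]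
  refine Submodule.sum_mem _ (fun c _ => ?_)
  rw [Polynomial.sum_def]
  refine Submodule.sum_mem _ (fun i hi => ?_)
  have hc : α c ∈ Polynomial.degreeLT ℂ w := hα c (Set.mem_univ c)
  rw [Polynomial.mem_degreeLT] at hc
  have hiw : i < w := by
    have h1 := Polynomial.le_degree_of_ne_zero (Polynomial.mem_support_iff.1 hi)
    exact Nat.cast_lt.1 (h1.trans_lt hc)
  exact Submodule.smul_mem _ _ (hclR_iterate_divX_mem_K e K hK w c i hiw)

/-- The tuple `single c (X ^ i)` with `i < w` has all components of degree `< w`. -/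
theorem hclR_single_X_pow_mem_pi_degreeLT (w : ℕ) (c : Fin r) (i : ℕ) (hi : i < w) :
    (Pi.single c (X ^ i) : Fin r → ℂ[X]) ∈
      Submodule.pi Set.univ (fun _ : Fin r => Polynomial.degreeLT ℂ w) := by
  intro c' _
  rcases eq_or_ne c' c with rfl | h
  · rw [Pi.single_eq_same]
    exact Polynomial.mem_degreeLT.2 ((degree_X_pow_le i).trans_lt (Nat.cast_lt.2 hi))
  · rw [Pi.single_eq_of_ne h]
    exact Submodule.zero_mem _

/-- `Ev (degree < w) = K w`: the evaluation map sends the degree-`< w` coefficient tuples onto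
the Krylov space. -/
theorem hclR_Ev_map_pi_degreeLT (K : ℕ → Submodule ℂ ℂ[X])
    (hK : ∀ w, K w = Submodule.span ℂ (Set.range (fun p : Fin r × Fin w =>
      Polynomial.divX^[(Prod.snd p).val] (e (Prod.fst p)))))
    (Ev : (Fin r → ℂ[X]) →ₗ[ℂ] ℂ[X])
    (hEv : Ev = ∑ c : Fin r, LinearMap.comp
      (Polynomial.lsum (fun (i : ℕ) => LinearMap.smulRight (LinearMap.id : ℂ →ₗ[ℂ] ℂ)
        (Polynomial.divX^[i] (e c))) : ℂ[X] →ₗ[ℂ] ℂ[X])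
      (LinearMap.proj c : (Fin r → ℂ[X]) →ₗ[ℂ] ℂ[X]))
    (w : ℕ) :
    Submodule.map Ev (Submodule.pi Set.univ (fun _ : Fin r => Polynomial.degreeLT ℂ w)) = K w := by
  apply le_antisymm
  · exact Submodule.map_le_iff_le_comap.2 (fun α hα => hclR_Ev_mem_K e K hK Ev hEv w α hα)
  · rw [hK, Submodule.span_le]
    rintro _ ⟨⟨c, i⟩, rfl⟩
    exact ⟨Pi.single c (X ^ i.val), hclR_single_X_pow_mem_pi_degreeLT w c i.val i.isLt,
      hclR_Ev_single_X_pow e Ev hEv c i.val⟩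

/-! ## Rank–nullity -/

/-- The degree-`< w` tuples are the range of the (injective) componentwise inclusion of
`Fin r → degreeLT ℂ w`. -/
theorem hclR_pi_degreeLT_eq_range (w : ℕ) :
    Submodule.pi Set.univ (fun _ : Fin r => Polynomial.degreeLT ℂ w) =
      LinearMap.range ((Polynomial.degreeLT ℂ w).subtype.compLeft (Fin r)) := by
  rw [LinearMap.range_compLeft, Submodule.range_subtype]

/-- The degree-`< w` tuples form a finite-dimensional space. -/
theorem hclR_pi_degreeLT_finiteDimensional (w : ℕ) :
    FiniteDimensional ℂ ↥(Submodule.pi Set.univ (fun _ : Fin r => Polynomial.degreeLT ℂ w)) := by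
  rw [hclR_pi_degreeLT_eq_range]
  infer_instance

/-- The degree-`< w` tuples have dimension `r w`. -/
theorem hclR_finrank_pi_degreeLT (w : ℕ) :
    Module.finrank ℂ ↥(Submodule.pi Set.univ (fun _ : Fin r => Polynomial.degreeLT ℂ w)) =
      r * w := by
  rw [hclR_pi_degreeLT_eq_range, LinearMap.finrank_range_of_inj]
  · rw [Module.finrank_pi_fintype, Finset.sum_const, Finset.card_univ, Fintype.card_fin,
      smul_eq_mul, Module.finrank_eq_card_basis (Polynomial.degreeLT.basis ℂ w), Fintype.card_fin]
  · intro a b hab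
    funext i
    exact Subtype.val_injective (congr_fun hab i :)

/-- `dim (q.comap p.subtype) = dim (q ⊓ p)`: a submodule pulled back to `p` has the dimension of
the intersection. -/
theorem hclR_finrank_comap_subtype {M : Type*} [AddCommGroup M] [Module ℂ M]
    (p q : Submodule ℂ M) :
    Module.finrank ℂ ↥(Submodule.comap p.subtype q) = Module.finrank ℂ ↥(q ⊓ p) := by
  rw [← Submodule.finrank_map_subtype_eq p, Submodule.map_comap_subtype, inf_comm]

/-- Rank–nullity for the evaluation map on the degree-`< w` tuples:
`dim (ker Ev ⊓ (degree < w)) + dim K w = r w`. -/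
theorem hclR_finrank_ker_inf_add_finrank_K (K : ℕ → Submodule ℂ ℂ[X])
    (hK : ∀ w, K w = Submodule.span ℂ (Set.range (fun p : Fin r × Fin w =>
      Polynomial.divX^[(Prod.snd p).val] (e (Prod.fst p)))))
    (Ev : (Fin r → ℂ[X]) →ₗ[ℂ] ℂ[X])
    (hEv : Ev = ∑ c : Fin r, LinearMap.comp
      (Polynomial.lsum (fun (i : ℕ) => LinearMap.smulRight (LinearMap.id : ℂ →ₗ[ℂ] ℂ)
        (Polynomial.divX^[i] (e c))) : ℂ[X] →ₗ[ℂ] ℂ[X])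
      (LinearMap.proj c : (Fin r → ℂ[X]) →ₗ[ℂ] ℂ[X]))
    (w : ℕ) :
    Module.finrank ℂ ↥(LinearMap.ker Ev ⊓
        Submodule.pi Set.univ (fun _ : Fin r => Polynomial.degreeLT ℂ w)) +
      Module.finrank ℂ ↥(K w) = r * w := by
  haveI := hclR_pi_degreeLT_finiteDimensional (r := r) w
  have key := LinearMap.finrank_range_add_finrank_ker
    (Ev.domRestrict (Submodule.pi Set.univ (fun _ : Fin r => Polynomial.degreeLT ℂ w)))
  rw [LinearMap.range_domRestrict, LinearMap.ker_domRestrict,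
    hclR_Ev_map_pi_degreeLT e K hK Ev hEv w, hclR_finrank_comap_subtype,
    hclR_finrank_pi_degreeLT] at key
  omega

/-! ## Concavity of the Krylov dimensions -/

/-- Abstract concavity step.  If `K₀ ≤ K₁`, `D K₀ ≤ K₁` and `K₂ = K₁ ⊔ D K₁` then
`dim K₂ + dim K₀ ≤ 2 dim K₁`: by rank–nullity for `D` on `K₀` and on `K₁`
(`dim D Kⱼ + dim (ker D ⊓ Kⱼ) = dim Kⱼ`), the modular law for `K₁ ⊔ D K₁`, and the inclusions
`ker D ⊓ K₀ ≤ ker D ⊓ K₁`, `D K₀ ≤ K₁ ⊓ D K₁`. -/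
theorem hclR_finrank_concave_step {M : Type*} [AddCommGroup M] [Module ℂ M] (D : M →ₗ[ℂ] M)
    (K₀ K₁ K₂ : Submodule ℂ M) [FiniteDimensional ℂ K₀] [FiniteDimensional ℂ K₁]
    (h01 : K₀ ≤ K₁) (hD0 : Submodule.map D K₀ ≤ K₁) (h2 : K₂ = K₁ ⊔ Submodule.map D K₁) :
    Module.finrank ℂ ↥K₂ + Module.finrank ℂ ↥K₀ ≤ 2 * Module.finrank ℂ ↥K₁ := by
  have hmod := Submodule.finrank_sup_add_finrank_inf_eq K₁ (Submodule.map D K₁)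
  have hrn1 := LinearMap.finrank_range_add_finrank_ker (D.domRestrict K₁)
  have hrn0 := LinearMap.finrank_range_add_finrank_ker (D.domRestrict K₀)
  rw [LinearMap.range_domRestrict, LinearMap.ker_domRestrict, hclR_finrank_comap_subtype]
    at hrn1 hrn0
  have hz : Module.finrank ℂ ↥(LinearMap.ker D ⊓ K₀) ≤
      Module.finrank ℂ ↥(LinearMap.ker D ⊓ K₁) :=
    Submodule.finrank_mono (inf_le_inf_left (LinearMap.ker D) h01)
  have hd : Module.finrank ℂ ↥(Submodule.map D K₀) ≤
      Module.finrank ℂ ↥(K₁ ⊓ Submodule.map D K₁) :=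
    Submodule.finrank_mono (le_inf hD0 (Submodule.map_mono h01))
  rw [h2]
  omega

/-- Concavity of the Krylov dimensions for a family `K` satisfying `hK`:
`dim K (w + 2) + dim K w ≤ 2 dim K (w + 1)`. -/
theorem hclR_finrank_K_concave (K : ℕ → Submodule ℂ ℂ[X])
    (hK : ∀ w, K w = Submodule.span ℂ (Set.range (fun p : Fin r × Fin w =>
      Polynomial.divX^[(Prod.snd p).val] (e (Prod.fst p)))))
    (w : ℕ) : Module.finrank ℂ ↥(K (w + 2)) + Module.finrank ℂ ↥(K w) ≤
      2 * Module.finrank ℂ ↥(K (w + 1)) := by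
  obtain ⟨D, hD⟩ := hclR_exists_divX_linear
  haveI := hclR_K_finiteDimensional e K hK w
  haveI := hclR_K_finiteDimensional e K hK (w + 1)
  exact hclR_finrank_concave_step D _ _ _ (hclR_K_mono e K hK w)
    (hclR_map_K_le_succ e K hK D hD w) (hclR_K_succ_succ e K hK D hD w)

/-! ## The registered statements (notation-free expansions) -/

/-- `Ev (degree < w) = K_w` (registered stub `hclR_EvL_map_degLT`): the evaluation map of the
frame `e` sends the degree-`< w` coefficient tuples onto the Krylov space `K_w`. -/
theorem hclR_EvL_map_degLT : ∀ {r : ℕ} (e : Fin r → Polynomial ℂ) (w : ℕ), Submodule.map ((∑ c : Fin r, LinearMap.comp (Polynomial.lsum (fun (i : ℕ) => LinearMap.smulRight (LinearMap.id : ℂ →ₗ[ℂ] ℂ) (Polynomial.divX^[i] (e c : Polynomial ℂ))) : Polynomial ℂ →ₗ[ℂ] Polynomial ℂ) (LinearMap.proj c : (Fin r → Polynomial ℂ) →ₗ[ℂ] Polynomial ℂ))) ((Submodule.pi Set.univ (fun _ : Fin r => Polynomial.degreeLT ℂ (w)) : Submodule ℂ (Fin r → Polynomial ℂ))) = (Submodule.span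 ℂ (Set.range (fun p : Fin (r) × Fin (w) => Polynomial.divX^[(Prod.snd p).val] ((e : Fin r → Polynomial ℂ) (Prod.fst p))))) := by
  intro r e w
  exact hclR_Ev_map_pi_degreeLT e (fun w => Submodule.span ℂ (Set.range
    (fun p : Fin r × Fin w => Polynomial.divX^[(Prod.snd p).val] (e (Prod.fst p)))))
    (fun _ => rfl) _ rfl w

/-- Rank–nullity `dim Rel_w + dim K_w = r w` (registered stub `hclR_finrank_RelL_add_KryL`). -/
theorem hclR_finrank_RelL_add_KryL : ∀ {r : ℕ} (e : Fin r → Polynomial ℂ) (w : ℕ), Module.finrank ℂ ↥((LinearMap.ker (∑ c : Fin r, LinearMap.comp (Polynomial.lsum (fun (i : ℕ) => LinearMap.smulRight (LinearMap.id : ℂ →ₗ[ℂ] ℂ) (Polynomial.divX^[i] (e c : Polynomial ℂ))) : Polynomial ℂ →ₗ[ℂ] Polynomial ℂ) (LinearMap.proj c : (Fin r → Polynomial ℂ) →ₗ[ℂ] Polynomial ℂ)) ⊓ (Submodule.pi Set.univ (fun _ : Fin r => Polynomial.degreeLT ℂ (w)) : Submodule ℂ (Fin r → Polynomial ℂ))))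 + Module.finrank ℂ ↥((Submodule.span ℂ (Set.range (fun p : Fin (r) × Fin (w) => Polynomial.divX^[(Prod.snd p).val] ((e : Fin r → Polynomial ℂ) (Prod.fst p)))))) = r * w := by
  intro r e w
  exact hclR_finrank_ker_inf_add_finrank_K e (fun w => Submodule.span ℂ (Set.range
    (fun p : Fin r × Fin w => Polynomial.divX^[(Prod.snd p).val] (e (Prod.fst p)))))
    (fun _ => rfl) _ rfl w

/-- `K_{w+1} = span e ⊔ span (divX '' K_w)` (registered stub `hclR_KryL_succ`). -/
theorem hclR_KryL_succ : ∀ {r : ℕ} (e : Fin r → Polynomial ℂ) (w : ℕ), (Submodule.span ℂ (Set.range (fun p : Fin (r) × Fin (w + 1) => Polynomial.divX^[(Prod.snd p).val] ((e : Fin r → Polynomial ℂ) (Prod.fst p))))) = Submodule.span ℂ (Set.range e) ⊔ Submodule.span ℂ (Polynomial.divX '' ((Submodule.span ℂ (Set.range (fun p : Fin (r) × Fin (w) => Polynomial.divX^[(Prod.snd p).val] ((e : Fin r → Polynomial ℂ) (Prod.fst p))))) : Set (Polynomial ℂ))) := by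
  intro r e w
  exact hclR_K_succ e (fun w => Submodule.span ℂ (Set.range
    (fun p : Fin r × Fin w => Polynomial.divX^[(Prod.snd p).val] (e (Prod.fst p)))))
    (fun _ => rfl) w

/-- (K1) Concavity of the Krylov dimensions `κ_{w+2} + κ_w ≤ 2 κ_{w+1}` (registered stub
`hclR_KryL_concave`): the increments `κ_{j+1} - κ_j` are non-increasing. -/
theorem hclR_KryL_concave : ∀ {r : ℕ} (e : Fin r → Polynomial ℂ) (w : ℕ), Module.finrank ℂ ↥((Submodule.span ℂ (Set.range (fun p : Fin (r) × Fin (w + 2) => Polynomial.divX^[(Prod.snd p).val] ((e : Fin r → Polynomial ℂ) (Prod.fst p)))))) + Module.finrank ℂ ↥((Submodule.span ℂ (Set.range (fun p : Fin (r) × Fin (w) => Polynomial.divX^[(Prod.snd p).val] ((e : Fin r → Polynomial ℂ) (Prod.fst p)))))) ≤ 2 * Module.finrank ℂ ↥((Submodule.span ℂ (Set.range (fun p : Fin (r) × Fin (w + 1) => Polynomial.divX^[(Prod.snd p).val] ((e : Fin r → Polynomial ℂ) (Prod.fst p)))))) := by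
  intro r e w
  exact hclR_finrank_K_concave e (fun w => Submodule.span ℂ (Set.range
    (fun p : Fin r × Fin w => Polynomial.divX^[(Prod.snd p).val] (e (Prod.fst p)))))
    (fun _ => rfl) w

/-- `K_w ≤ K_{w+1}` (registered stub `hclR_KryL_mono`). -/
theorem hclR_KryL_mono : ∀ {r : ℕ} (e : Fin r → Polynomial ℂ) (w : ℕ), (Submodule.span ℂ (Set.range (fun p : Fin (r) × Fin (w) => Polynomial.divX^[(Prod.snd p).val] ((e : Fin r → Polynomial ℂ) (Prod.fst p))))) ≤ (Submodule.span ℂ (Set.range (fun p : Fin (r) × Fin (w + 1) => Polynomial.divX^[(Prod.snd p).val] ((e : Fin r → Polynomial ℂ) (Prod.fst p))))) := by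
  intro r e w
  exact hclR_K_mono e (fun w => Submodule.span ℂ (Set.range
    (fun p : Fin r × Fin w => Polynomial.divX^[(Prod.snd p).val] (e (Prod.fst p)))))
    (fun _ => rfl) w

end Summit.MatrixMultiplication.MatrixMultiplication.Theorems
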